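import Summits.QuantumFields.YangMills.Theorems.BalabanUVNodesPortU2Chart
import Summits.QuantumFields.YangMills.Theorems.UnitScaleTiltSmoothLiftInterpTools

/-!
# PT-C (`stmt-QuantumFields-27932`, R-O2 ∕ R-J) HELPER: the chart of record MAPS print's (4.4) domain INTO `U^c_{k+1}(X, α₀, α₁)`
# OF RECORD — conditions (i)–(iv) at the names for the charted pair, generic in the `𝐉`-slot; the plaquette estimate in circulation form

[I] = T. Bałaban, *Renormalization group approach to lattice gauge field theories. I*, Commun. Math. Phys. **109** (1987)
249–301 [Balaban1987RG1]: (1.9)–(1.16) p. 262 (the pairs `(𝐔, 𝐉)`, the four conditions, the union of orbits), (4.4) p. 281.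

Cell `pub-ymgap`, seat `pub-ymgap-dag-n07-e` g37 (director-ym №447: PT-C MINE; №449 ∕ CRIT-1 ‼ (R-J): «dag-n07-e's U-block chart work — file
it as `--supports stmt-QuantumFields-27932` HELPERS … NOT as the closing theorem of 27932‴» — the row's text is being re-cut with a J-block
`recordChartJ ∕ recordDom44J` (DEF-1 ed. 7 ✓p793840), whose `MapsTo` is THIS file's `satisfies_chartPair` (generic 𝐉-slot) plus
«`‖w_J‖ < α₂ ≤ γ₀` immediate»).  REUSED BY NAME, nothing restated: DEF-1's names ∕ lemmas (✓p793840 ∕ ✓p793420: `recordDom44`, `recordUc`,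
`recordChart`, `chartMatLM`, `convex_balanced_isOpen_recordDom44`, `zero_mem_recordDom44`), porter PTC-1's ✓p794088 `BalabanUVNodesPortU2Chart`
(`trace_chartMat`, `det_exp_chartMat`, `analyticAt_recordChart`), the tree's `SmoothLiftInterp.norm_prod_exp_sub_one_sub_sum_le`
(second-order expansion of an ordered product of exponentials), `B12RegularSpaces111(SpecialUnitary)`, `Beta.BackgroundVertices.expUnit`.

WHAT IS PROVED (kernel).  Fix `F`, `Mc`, `k`, `K`, `X ∈ 𝐃_{k+1}(T_K)`, radii `0 < α₀`, `α₁`, and a chart radius `α₂` with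
`0 < α₂ ≤ 1∕4`, `α₂ ≤ α₁`, `α₂ ≤ α₀∕36` (e.g. `α₂ := min (1∕4) (min α₁ (α₀∕36))`, uniform in `k, K, X`).
* §1 `norm_plaquette_exp_sub_one_le` — in any complete normed `ℂ`-algebra with `‖1‖ = 1`, for `S := Σ‖X_i‖ ≤ 1`:
  `‖e^{X₁}e^{X₂}e^{−X₃}e^{−X₄} − 1‖ ≤ ‖X₁ + X₂ − X₃ − X₄‖ + S²` (second order in the sizes, FIRST order only through the circulation
  `X₁ + X₂ − X₃ − X₄` — the shape (1.11) needs; PTC-1's `norm_plaquette_exp_sub_one_le_scaled` is the `2C(1+C)e^{4C}ξ²` cousin).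
* §2 `eta_le_one` (`ξ = L^{−j} ≤ 1`), `shift_shift_comm`, `expUnit_chartMat_mem_Gc` (`exp W(b) ∈ Gᶜ = SL(2, ℂ)` by PTC-1's `det_exp_chartMat`).
* §3 `condIV_record` — **condition (iv) (1.15)–(1.16) holds at the record for EVERY configuration**: the residual functions of record are
  the UNIT recipe (`RzOfRecord = Sect2.Residual.unit`: `U_n(M˙(·)) ≡ 1`, `J_n ≡ 0`), so (1.16) reads `0 < α₀ξ²`, `0 < α₀(Lⁿξ)²`.
  HONEST (director-ym №447 (4) annex, displayed): VACUOUS content until that placeholder body is swapped by its own docketed event.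
* §4 `satisfies_chartPair` — for `w ∈ recordDom44 F Mc k K X α₂` and ANY `𝐉`-slot `J` that is traceless with `‖J b‖ < α₀` on the bonds
  of `X`, the pair `(𝐔, 𝐉)`, `𝐔(b) = exp W(b)` on `X` (`W(b) = chartMat F K w b`), `1` off `X`, SATISFIES (i)–(iv) of record with the
  factorisation `𝐔 = (exp iξA′)·U`, **`U := 1`, `A′ := (iξ)⁻¹ W`** (`ξ = L^{−(k+1)}`): (i) `|∂1 − 1| = 0 < α₀ξ²`, local gauge `u = 1, A = 0`
  (`0 < O(1)LMB·α₀`, `O(1)LMB = 6L + 1` of record); (ii) `A′` traceless, `|A′| = ξ⁻¹|W| < α₂ ≤ α₁`, `∇^ξ_1 = ∇^ξ` (`nabla_one`) and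
  `|∇^ξA′| = ξ⁻²|W(b + e_μ) − W(b)| < α₂ ≤ α₁` by the second clause of (4.4) (both bonds lie in `X` on `regionOfSet`'s pairs);
  (iii) `|𝐉| < α₀ = γ₀` by hypothesis and, on the plaquettes inside `X`, §1's estimate
  `|e^{W₁}e^{W₂}e^{−W₃}e^{−W₄} − 1| ≤ |(W₂ − W₄) − (W₃ − W₁)| + (Σ|W_i|)² < (2α₂ + 16α₂²)ξ² ≤ 6α₂ξ² < α₀ξ²`; (iv) §3.
* §5 `recordChart_mapsTo` — **`Set.MapsTo (recordChart F Mc k K X) (recordDom44 F Mc k K X α₂) (recordUc F Mc k α₀ α₁ K X)`**: the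
  (J-free) chart of record (`𝐉 = 0`) lands in the union of orbits (its own orbit, `u = 1`), read back through `decodeCfg ∘ encodeCfg = id`.
  With DEF-1's `convex_balanced_isOpen_recordDom44` ∕ `zero_mem_recordDom44` and PTC-1's `analyticOnNhd_recordChart` these are all six
  (4.4) clauses of the receipt `Chart44DAt` at the J-free names — NOT assembled into a closing theorem here (the row waits for (R-J)).

HONEST FRAMING.  Count-neutral helper for a porter row (rank 9); bookkeeping at the record's names plus one plaquette estimate — NOT a
port of [I] (3.36)–(3.54); nothing of Bałaban's analysis discharged; 27930 ∕ 27931 ∕ 27932 ∕ 26648 OPEN; K0⁷ `Record13SepCoPHInhabited` NOT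
closed; NODE O not inhabited; COUNT 8∕28 · K 1∕4 UNMOVED; one finite `𝕋⁴_{L^K}` programme at fixed ε — NOT continuum ∕ ℝ⁴ ∕ OS; **the
Yang–Mills mass gap (Clay) is NOT proved by any of this.**  No `sorry`, no `def`, no `instance`, no `notation`; standard axioms.
-/

noncomputable section

open scoped BigOperators Matrix.Norms.L2Operator

namespace Summit.QuantumFields.YangMills.Theorems.K0PortChart44DMapsTo

open Literature.MathematicalPhysics.QuantumFieldTheory.Balaban1983to89
open Literature.MathematicalPhysics.QuantumFieldTheory.Balaban1983to89.Node00
open Literature.MathematicalPhysics.QuantumFieldTheory.Balaban1983to89.T4Continuum (T4Family)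
open Summit.QuantumFields.YangMills.Theorems.K0RecordFormatNames
open NormedSpace (exp)

/-! ## §1  The plaquette estimate in circulation form -/

section ExpEstimates

variable {𝔸 : Type*} [NormedRing 𝔸] [NormedAlgebra ℂ 𝔸] [NormOneClass 𝔸] [CompleteSpace 𝔸]

/-- **The plaquette estimate.**  For `X₁, X₂, X₃, X₄` with `Σ‖X_i‖ ≤ 1`:
`‖e^{X₁} e^{X₂} e^{−X₃} e^{−X₄} − 1‖ ≤ ‖X₁ + X₂ − X₃ − X₄‖ + (Σ‖X_i‖)²` — the second-order expansion of an ordered product of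
exponentials (the tree's `SmoothLiftInterp.norm_prod_exp_sub_one_sub_sum_le`, REUSED) plus `e^S − 1 − S ≤ S²` on `[0, 1]`. [folklore] -/
theorem norm_plaquette_exp_sub_one_le (X₁ X₂ X₃ X₄ : 𝔸) (hS : ‖X₁‖ + ‖X₂‖ + ‖X₃‖ + ‖X₄‖ ≤ 1) :
    ‖exp X₁ * exp X₂ * exp (-X₃) * exp (-X₄) - 1‖ ≤
      ‖X₁ + X₂ - X₃ - X₄‖ + (‖X₁‖ + ‖X₂‖ + ‖X₃‖ + ‖X₄‖) ^ 2 := by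
  have h := SmoothLiftInterp.norm_prod_exp_sub_one_sub_sum_le [X₁, X₂, -X₃, -X₄]
  simp only [List.map_cons, List.map_nil, List.prod_cons, List.prod_nil, List.sum_cons, List.sum_nil, norm_neg,
    mul_one, add_zero] at h
  set S := ‖X₁‖ + ‖X₂‖ + ‖X₃‖ + ‖X₄‖ with hSdef
  have hS0 : 0 ≤ S := by positivity
  have hreal : Real.exp (‖X₁‖ + (‖X₂‖ + (‖X₃‖ + ‖X₄‖))) - 1 - (‖X₁‖ + (‖X₂‖ + (‖X₃‖ + ‖X₄‖))) ≤ S ^ 2 := by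
    have e : ‖X₁‖ + (‖X₂‖ + (‖X₃‖ + ‖X₄‖)) = S := by simp only [hSdef]; ring
    rw [e]
    have hb := Real.abs_exp_sub_one_sub_id_le (x := S) (by rwa [abs_of_nonneg hS0])
    exact (le_abs_self _).trans hb
  have hprod : exp X₁ * exp X₂ * exp (-X₃) * exp (-X₄) = exp X₁ * (exp X₂ * (exp (-X₃) * exp (-X₄))) := by
    simp only [mul_assoc]
  have hsum : X₁ + X₂ - X₃ - X₄ = X₁ + (X₂ + (-X₃ + -X₄)) := by abel
  rw [hprod]
  calc ‖exp X₁ * (exp X₂ * (exp (-X₃) * exp (-X₄))) - 1‖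
      = ‖(exp X₁ * (exp X₂ * (exp (-X₃) * exp (-X₄))) - 1 - (X₁ + (X₂ + (-X₃ + -X₄)))) + (X₁ + X₂ - X₃ - X₄)‖ := by
        rw [hsum, sub_add_cancel]
    _ ≤ ‖exp X₁ * (exp X₂ * (exp (-X₃) * exp (-X₄))) - 1 - (X₁ + (X₂ + (-X₃ + -X₄)))‖ + ‖X₁ + X₂ - X₃ - X₄‖ :=
        norm_add_le _ _
    _ ≤ S ^ 2 + ‖X₁ + X₂ - X₃ - X₄‖ := by gcongr; exact h.trans hreal
    _ = ‖X₁ + X₂ - X₃ - X₄‖ + S ^ 2 := add_comm _ _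

end ExpEstimates

/-! ## §2  Bookkeeping at the names: `ξ ≤ 1`, commuting shifts, `exp W ∈ Gᶜ` -/

section Record

variable (F : T4Family)

/-- `ξ = L^{−j} ≤ 1`. [cite: Balaban1987RG1, (1.1) p.260 (bookkeeping)] -/
theorem eta_le_one (K j : ℕ) : (F.P K).eta j ≤ 1 := by
  unfold Params.eta
  have hL : (1 : ℝ) ≤ (F.P K).L := by exact_mod_cast (F.P K).hL.2.le
  exact pow_le_one₀ (inv_nonneg.2 (zero_le_one.trans hL)) (inv_le_one_of_one_le₀ hL)

/-- Lattice shifts commute: `(x + e_μ) + e_ν = (x + e_ν) + e_μ`. [folklore] -/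
theorem shift_shift_comm {P : Params} {j : ℕ} (x : Site P j) (μ ν : Fin P.d) :
    (x.shift μ).shift ν = (x.shift ν).shift μ := by
  by_cases h : μ = ν
  · subst h; rfl
  · funext i
    simp only [Site.shift, Function.update_apply]
    by_cases hiν : i = ν <;> by_cases hiμ : i = μ <;> simp [hiν, hiμ, h, Ne.symm h]

/-- The charted bond variable `exp W(b)` lies in `Gᶜ = SL(2, ℂ)`. [cite: Balaban1987RG1, (1.10)–(1.11) p.262] -/
theorem expUnit_chartMat_mem_Gc (K : ℕ) (w : Fin (recordChartDim F K) → ℂ) (b : PBond (F.P K) 0) :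
    Beta.BackgroundVertices.expUnit ℂ (chartMat F K w b) ∈ (B12RegularSpaces111SpecialUnitary.suModel 2).Gc := by
  rw [B12RegularSpaces111SpecialUnitary.mem_suModel_Gc]
  exact PortU2.det_exp_chartMat F K w b

/-! ## §3  Condition (iv) at the unit residual recipe of record -/

/-- **Condition (iv) at the record is met by every configuration**: the residual functions of record are the UNIT recipe
(`RzOfRecord = Sect2.Residual.unit`: `U_n(M˙(·)) ≡ 1`, `J_n ≡ 0`), so (1.16) reads `0 < α₀ξ²`, `0 < α₀(Lⁿξ)²`.  HONEST: vacuous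
content until the placeholder body is swapped. [cite: Balaban1987RG1, (1.15)–(1.16) p.262] -/
theorem condIV_record (Mc k K : ℕ) (X : (recordDomSys F Mc k K).Dom) {α₀ : ℝ} (hα₀ : 0 < α₀)
    (V : PBond (F.P K) 0 → (MatA 2)ˣ) :
    B12RegularSpaces111.CondIV
      (Sect2.frameI (RzOfRecord F 2 K) Mc (k + 1) (Sect2.domSites (F.P K) Mc (k + 1) X)).bg
      (Sect2.frameI (RzOfRecord F 2 K) Mc (k + 1) (Sect2.domSites (F.P K) Mc (k + 1) X)).X₂
      (B12RegularSpaces111.StepConsts.ofParams (F.P K) (recordCB F) (k + 1)) α₀ V where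
  plaq_lt := by
    intro n _ _ p _
    have hξ : 0 < (F.P K).eta (k + 1) := pow_pos (inv_pos.mpr (Nat.cast_pos.mpr (F.P K).L_pos)) _
    have h1 : (Sect2.frameI (RzOfRecord F 2 K) Mc (k + 1) (Sect2.domSites (F.P K) Mc (k + 1) X)).bg.Un n V = 1 := rfl
    rw [h1, B12RegularSpaces111.plaq_eq]
    simp only [Pi.one_apply, inv_one, mul_one, Units.val_one, sub_self, norm_zero, B12RegularSpaces111.StepConsts.ofParams]
    positivity
  J_lt := by
    intro n _ _ b _
    have hξ : 0 < (F.P K).eta (k + 1) := pow_pos (inv_pos.mpr (Nat.cast_pos.mpr (F.P K).L_pos)) _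
    have hL : (0 : ℝ) < (F.P K).L := by exact_mod_cast (F.P K).L_pos
    have h1 : (Sect2.frameI (RzOfRecord F 2 K) Mc (k + 1) (Sect2.domSites (F.P K) Mc (k + 1) X)).bg.Jn n V b = 0 := rfl
    rw [h1, norm_zero]
    simp only [B12RegularSpaces111.StepConsts.ofParams]
    positivity

/-! ## §4  The charted pair satisfies (i)–(iv) of record, for any admissible `𝐉`-slot -/

open scoped Classical in
/-- **The charted pair SATISFIES (i)–(iv) of record.**  For `w` in the (4.4) domain of radius `α₂` (`0 < α₂ ≤ 1∕4`, `α₂ ≤ α₁`,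
`α₂ ≤ α₀∕36`) and a `𝐉`-slot that is traceless and of norm `< α₀` on the bonds of `X`, the pair `(exp W on X ∕ 1 off X, 𝐉)` satisfies
the four conditions with `U := 1`, `A′ := (iξ)⁻¹ W` (module docstring for the estimates). [cite: Balaban1987RG1, (1.11)–(1.16) p.262, (4.4) p.281] -/
theorem satisfies_chartPair (Mc k K : ℕ) (X : (recordDomSys F Mc k K).Dom) {α₀ α₁ α₂ : ℝ} (hα₀ : 0 < α₀) (hα₂ : 0 < α₂)
    (hα₂q : α₂ ≤ 1 / 4) (hα₂₁ : α₂ ≤ α₁) (hα₂₀ : α₂ ≤ α₀ / 36)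
    {w : Fin (recordChartDim F K) → ℂ} (hw : w ∈ recordDom44 F Mc k K X α₂)
    (J : PBond (F.P K) 0 → MatA 2) (hJtr : ∀ b ∈ domBonds F Mc k K X, (J b).trace = 0)
    (hJlt : ∀ b ∈ domBonds F Mc k K X, ‖J b‖ < α₀) :
    B12RegularSpaces111.Satisfies (B12RegularSpaces111SpecialUnitary.suModel 2)
      (Sect2.frameI (RzOfRecord F 2 K) Mc (k + 1) (Sect2.domSites (F.P K) Mc (k + 1) X))
      (B12RegularSpaces111.StepConsts.ofParams (F.P K) (recordCB F) (k + 1)) α₀ α₁ α₀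
      ⟨fun b => if b ∈ domBonds F Mc k K X then Beta.BackgroundVertices.expUnit ℂ (chartMat F K w b) else 1, J⟩ := by
  obtain ⟨hw1, hw2, -⟩ := hw
  have hξ : 0 < (F.P K).eta (k + 1) := pow_pos (inv_pos.mpr (Nat.cast_pos.mpr (F.P K).L_pos)) _
  have hξ1 : (F.P K).eta (k + 1) ≤ 1 := eta_le_one F K (k + 1)
  have hIξ : (Complex.I * ((F.P K).eta (k + 1) : ℂ)) ≠ 0 :=
    mul_ne_zero Complex.I_ne_zero (by exact_mod_cast hξ.ne')
  have hcB : 0 < recordCB F * α₀ := by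
    rw [recordCB, sect2NumericsOfThm1C_cB]; positivity
  refine ⟨fun b hb => ?_, fun b hb => ?_, 1,
    fun b => if b ∈ domBonds F Mc k K X then (Complex.I * ((F.P K).eta (k + 1) : ℂ))⁻¹ • chartMat F K w b else 0,
    fun b => ?_, ?_, ?_, ?_, condIV_record F Mc k K X hα₀ _, condIV_record F Mc k K X hα₀ _⟩
  · -- `𝐔` is `Gᶜ`-valued on `X`
    have hb' : b ∈ domBonds F Mc k K X := hb
    simp only [if_pos hb']
    exact expUnit_chartMat_mem_Gc F K w b
  · -- `𝐉` is `𝔤ᶜ`-valued on `X`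
    have hb' : b ∈ domBonds F Mc k K X := hb
    exact B12RegularSpaces111SpecialUnitary.mem_suModel_gc.2 (hJtr b hb')
  · -- the factorisation `𝐔 = exp iξA′ · 1`
    rw [Pi.one_apply, mul_one]
    by_cases hb : b ∈ domBonds F Mc k K X
    · simp only [if_pos hb, B12RegularSpaces111.expI, B12RegularSpaces111.StepConsts.ofParams, smul_smul,
        mul_inv_cancel₀ hIξ, one_smul]
    · simp only [if_neg hb, B12RegularSpaces111.expI, smul_zero]
      exact Units.ext (by simp)
  · -- (i) for `U = 1`
    refine ⟨fun b _ => (B12RegularSpaces111SpecialUnitary.suModel 2).G.one_mem, fun p _ => ?_, fun C _ => ?_⟩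
    · rw [B12RegularSpaces111.plaq_eq]
      simp only [Pi.one_apply, inv_one, mul_one, Units.val_one, sub_self, norm_zero, B12RegularSpaces111.StepConsts.ofParams]
      positivity
    · refine ⟨1, fun _ => (B12RegularSpaces111SpecialUnitary.suModel 2).G.one_mem, 0, fun b _ => ?_, fun b _ => ?_,
        fun q _ => ?_⟩
      · simp only [B12RegularSpaces111.gaugeU, Pi.one_apply, inv_one, mul_one, Pi.zero_apply, B12RegularSpaces111.expI,
          smul_zero]
        exact Units.ext (by simp)
      · simpa only [Pi.zero_apply, norm_zero, B12RegularSpaces111.StepConsts.ofParams] using hcB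
      · simpa only [B12RegularSpaces111.grad, Pi.zero_apply, sub_self, smul_zero, norm_zero,
          B12RegularSpaces111.StepConsts.ofParams] using hcB
  · -- (ii) for `A′ = (iξ)⁻¹ W` in the background `U = 1`
    refine ⟨fun b hb => ?_, fun b hb => ?_, fun q hq => ?_⟩
    · have hb' : b ∈ domBonds F Mc k K X := hb
      simp only [if_pos hb']
      exact Submodule.smul_mem _ _ (B12RegularSpaces111SpecialUnitary.mem_suModel_gc.2 (PortU2.trace_chartMat F K w b))
    · have hb' : b ∈ domBonds F Mc k K X := hb
      have h := hw1 b hb'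
      simp only [if_pos hb']
      rw [norm_smul, norm_inv, norm_mul, Complex.norm_I, one_mul, Complex.norm_real, Real.norm_of_nonneg hξ.le]
      calc ((F.P K).eta (k + 1))⁻¹ * ‖chartMat F K w b‖
          < ((F.P K).eta (k + 1))⁻¹ * (α₂ * (F.P K).eta (k + 1)) := mul_lt_mul_of_pos_left h (inv_pos.2 hξ)
        _ = α₂ := by field_simp
        _ ≤ α₁ := hα₂₁
    · obtain ⟨hx, hxμ, hxν, hxμν⟩ := hq
      have hb1 : (⟨q.1, q.2.2⟩ : PBond (F.P K) 0) ∈ domBonds F Mc k K X := ⟨hx, hxν⟩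
      have hb2 : (⟨q.1.shift q.2.1, q.2.2⟩ : PBond (F.P K) 0) ∈ domBonds F Mc k K X := ⟨hxμ, hxμν⟩
      have h := hw2 ⟨q.1, q.2.2⟩ hb1 q.2.1 hb2
      rw [B12RegularSpaces111.nabla_one]
      simp only [B12RegularSpaces111.grad, if_pos hb1, if_pos hb2, B12RegularSpaces111.StepConsts.ofParams]
      rw [← smul_sub, smul_smul, norm_smul, norm_mul, norm_inv, norm_inv, norm_mul, Complex.norm_I, one_mul,
        Complex.norm_real, Real.norm_of_nonneg hξ.le]
      calc ((F.P K).eta (k + 1))⁻¹ * ((F.P K).eta (k + 1))⁻¹ *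
            ‖chartMat F K w ⟨q.1.shift q.2.1, q.2.2⟩ - chartMat F K w ⟨q.1, q.2.2⟩‖
          < ((F.P K).eta (k + 1))⁻¹ * ((F.P K).eta (k + 1))⁻¹ * (α₂ * (F.P K).eta (k + 1) ^ 2) :=
            mul_lt_mul_of_pos_left h (by positivity)
        _ = α₂ := by field_simp
        _ ≤ α₁ := hα₂₁
  · -- (iii): the plaquette estimate on the plaquettes inside `X`, and `|𝐉| < γ₀ = α₀`
    refine ⟨fun p hp => ?_, fun b hb => hJlt b hb⟩
    obtain ⟨hx, hxμ, hxν, hxμν⟩ := hp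
    have hνμ : (p.src.shift p.ν).shift p.μ ∈ Sect2.domSites (F.P K) Mc (k + 1) X := by
      rw [shift_shift_comm]; exact hxμν
    have hb1 : (⟨p.src, p.μ⟩ : PBond (F.P K) 0) ∈ domBonds F Mc k K X := ⟨hx, hxμ⟩
    have hb2 : (⟨p.src.shift p.μ, p.ν⟩ : PBond (F.P K) 0) ∈ domBonds F Mc k K X := ⟨hxμ, hxμν⟩
    have hb3 : (⟨p.src.shift p.ν, p.μ⟩ : PBond (F.P K) 0) ∈ domBonds F Mc k K X := ⟨hxν, hνμ⟩
    have hb4 : (⟨p.src, p.ν⟩ : PBond (F.P K) 0) ∈ domBonds F Mc k K X := ⟨hx, hxν⟩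
    rw [B12RegularSpaces111.plaq_eq]
    simp only [if_pos hb1, if_pos hb2, if_pos hb3, if_pos hb4, Units.val_mul, Beta.BackgroundVertices.val_expUnit,
      Beta.BackgroundVertices.val_inv_expUnit, B12RegularSpaces111.StepConsts.ofParams]
    set ξ := (F.P K).eta (k + 1) with hξdef
    set W₁ := chartMat F K w ⟨p.src, p.μ⟩
    set W₂ := chartMat F K w ⟨p.src.shift p.μ, p.ν⟩
    set W₃ := chartMat F K w ⟨p.src.shift p.ν, p.μ⟩
    set W₄ := chartMat F K w ⟨p.src, p.ν⟩
    have n1 : ‖W₁‖ < α₂ * ξ := hw1 _ hb1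
    have n2 : ‖W₂‖ < α₂ * ξ := hw1 _ hb2
    have n3 : ‖W₃‖ < α₂ * ξ := hw1 _ hb3
    have n4 : ‖W₄‖ < α₂ * ξ := hw1 _ hb4
    have d24 : ‖W₂ - W₄‖ < α₂ * ξ ^ 2 := hw2 ⟨p.src, p.ν⟩ hb4 p.μ hb2
    have d31 : ‖W₃ - W₁‖ < α₂ * ξ ^ 2 := hw2 ⟨p.src, p.μ⟩ hb1 p.ν hb3
    have hS1 : ‖W₁‖ + ‖W₂‖ + ‖W₃‖ + ‖W₄‖ ≤ 1 := by nlinarith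
    have hS4 : ‖W₁‖ + ‖W₂‖ + ‖W₃‖ + ‖W₄‖ ≤ 4 * (α₂ * ξ) := by linarith
    have key := norm_plaquette_exp_sub_one_le W₁ W₂ W₃ W₄ hS1
    have hlin : ‖W₁ + W₂ - W₃ - W₄‖ ≤ ‖W₂ - W₄‖ + ‖W₃ - W₁‖ := by
      have e : W₁ + W₂ - W₃ - W₄ = (W₂ - W₄) - (W₃ - W₁) := by abel
      rw [e]; exact norm_sub_le _ _
    have hsq : (‖W₁‖ + ‖W₂‖ + ‖W₃‖ + ‖W₄‖) ^ 2 ≤ (4 * (α₂ * ξ)) ^ 2 :=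
      pow_le_pow_left₀ (by positivity) hS4 2
    have e1 : (4 * (α₂ * ξ)) ^ 2 ≤ 4 * (α₂ * ξ ^ 2) := by nlinarith
    have e2 : 6 * (α₂ * ξ ^ 2) < α₀ * ξ ^ 2 := by nlinarith [pow_pos hξ 2]
    calc ‖exp W₁ * exp W₂ * exp (-W₃) * exp (-W₄) - 1‖
        ≤ ‖W₁ + W₂ - W₃ - W₄‖ + (‖W₁‖ + ‖W₂‖ + ‖W₃‖ + ‖W₄‖) ^ 2 := key
      _ < (α₂ * ξ ^ 2 + α₂ * ξ ^ 2) + 4 * (α₂ * ξ ^ 2) :=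
          add_lt_add_of_lt_of_le (hlin.trans_lt (add_lt_add d24 d31)) (hsq.trans e1)
      _ = 6 * (α₂ * ξ ^ 2) := by ring
      _ < α₀ * ξ ^ 2 := e2

/-! ## §5  The chart of record maps the (4.4) domain into `U^c_{k+1}(X, α₀, α₁)` of record -/

/-- **THE MEMBERSHIP (MapsTo) CLAUSE for the chart of record** (`𝐉 = 0`): for `w` in the (4.4) domain of radius `α₂` (`0 < α₂ ≤ 1∕4`,
`α₂ ≤ α₁`, `α₂ ≤ α₀∕36`), the charted configuration lies in `U^c_{k+1}(X, α₀, α₁)` OF RECORD — its own orbit (`u = 1`), by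
`satisfies_chartPair`, read back through the coordinates (`decodeCfg ∘ encodeCfg = id`). [cite: Balaban1987RG1, (1.11)–(1.16) p.262, (4.4) p.281] -/
theorem recordChart_mapsTo (Mc k K : ℕ) (X : (recordDomSys F Mc k K).Dom) {α₀ α₁ α₂ : ℝ} (hα₀ : 0 < α₀) (hα₂ : 0 < α₂)
    (hα₂q : α₂ ≤ 1 / 4) (hα₂₁ : α₂ ≤ α₁) (hα₂₀ : α₂ ≤ α₀ / 36) :
    Set.MapsTo (recordChart F Mc k K X) (recordDom44 F Mc k K X α₂) (recordUc F Mc k α₀ α₁ K X) := by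
  classical
  intro w hw
  have hSat := satisfies_chartPair F Mc k K X hα₀ hα₂ hα₂q hα₂₁ hα₂₀ hw (fun _ => 0)
    (fun _ _ => by simp) (fun _ _ => by simpa using hα₀)
  rw [recordUc, Set.mem_preimage]
  refine ⟨_, B12RegularSpaces111.mem_space_of_satisfies hSat, ?_⟩
  simp only [recordChart, decodeCfg_encodeCfg]
  refine Prod.ext (funext fun b => ?_) (funext fun _ => rfl)
  simp only [Sect2.embedPair]
  split_ifs <;> simp

end Record

end Summit.QuantumFields.YangMills.Theorems.K0PortChart44DMapsTo
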